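import Mathlib.Analysis.InnerProductSpace.Calculus
import Mathlib.Analysis.Calculus.Deriv.MeanValue
import Mathlib.Analysis.Calculus.Deriv.Prod
import Mathlib.Topology.Order.Compact
import HarnessLib

/-!
# Injective immersed arcs stay injective under `C¹`-small perturbations

Topic `Literature/Topology/FourManifolds` (programme of the fact
`Literature.Topology.FourManifolds.exists_isSimplifiedBrokenLefschetzFibration`, Baykur–Saeki 2017, §2.1
p. 6: along the normal-crossing induction the injectivity of the map on each compact piece
of fold arc, read in a chart, must survive the later pushes).  Let `F : P × ℝ → ℝ²` be a
family of plane curves, continuous together with its `t`-derivative near `{p₀} × [a, b]`.  If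
the curve `F(p₀, ·)` is injective on `[a, b]` with nowhere vanishing velocity there, then so
is `F(p, ·)` for all `p` near `p₀`: near the diagonal a coordinate of the velocity keeps its
sign on uniform intervals (strict monotonicity), and off the diagonal the compact set of pairs
is handled by continuity of the values.

* `eventually_injOn_Icc_of_injOn`.

Everything is proved; no definitions, no named facts (D-0026).

## References

* R. İ. Baykur, O. Saeki, *Simplifying indefinite fibrations on 4-manifolds*, arXiv:1705.11169,
  §2.1, p. 6. [BaykurSaeki2017]
* M. W. Hirsch, *Differential Topology*, GTM 33 (1976), Ch. 2 §1 (stability of embeddings).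
  [HirschDT1976]
-/

noncomputable section

open Set Function Filter Metric
open scoped Topology

namespace Literature.Topology.FourManifolds

/-- Local notation: `𝔼 n` is the model Euclidean space `EuclideanSpace ℝ (Fin n)`. -/
local notation "𝔼 " n:arg => EuclideanSpace ℝ (Fin n)

/-- The derivative of a coordinate of a curve is the coordinate of the derivative. [folklore] -/
theorem hasDerivAt_apply_coord {f : ℝ → 𝔼 2} {f' : 𝔼 2} {t : ℝ} (h : HasDerivAt f f' t)
    (i : Fin 2) : HasDerivAt (fun t => f t i) (f' i) t := by
  rw [hasDerivAt_iff_hasFDerivAt, ← hasFDerivWithinAt_univ, hasFDerivWithinAt_euclidean] at h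
  have h2 := (hasFDerivWithinAt_univ.1 (h i)).hasDerivAt
  simpa using h2

/-- A curve for which a fixed multiple `σ` of one coordinate of the velocity is positive on an
open interval is injective there. [folklore] -/
theorem injOn_Ioo_of_deriv_coord_sign {f : ℝ → 𝔼 2} {c d : ℝ} (i : Fin 2) {σ : ℝ}
    (hdiff : ∀ t ∈ Ioo c d, DifferentiableAt ℝ f t)
    (hpos : ∀ t ∈ Ioo c d, 0 < σ * deriv f t i) : InjOn f (Ioo c d) := by
  set m : ℝ → ℝ := fun t => σ * f t i with hm
  have hmd : ∀ t ∈ Ioo c d, HasDerivAt m (σ * deriv f t i) t := fun t ht =>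
    (hasDerivAt_apply_coord (hdiff t ht).hasDerivAt i).const_mul σ
  have hmono : StrictMonoOn m (Ioo c d) := by
    refine strictMonoOn_of_deriv_pos (convex_Ioo c d)
      (fun t ht => (hmd t ht).continuousAt.continuousWithinAt) fun t ht => ?_
    rw [interior_Ioo] at ht
    rw [(hmd t ht).deriv]
    exact hpos t ht
  intro s hs t ht hst
  have h1 : m s = m t := by simp only [hm, hst]
  exact hmono.injOn hs ht h1

/-- **Injective immersed arcs are stable.**  Let `F : P → ℝ → ℝ²` be such that
`(p, t) ↦ F p t` and `(p, t) ↦ ∂ₜF p t` are continuous on `N × I` (`N` a neighbourhood of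
`p₀`, `I` an open set containing `[a, b]`) with `F p` differentiable on `I` for `p ∈ N`.  If
`F p₀` is injective on `[a, b]` with `∂ₜF p₀ ≠ 0` there, then `F p` is injective on `[a, b]`
for all `p` near `p₀`. [cite: HirschDT1976, Ch. 2 §1] [cite: BaykurSaeki2017, §2.1, p. 6] -/
theorem eventually_injOn_Icc_of_injOn {P : Type*} [TopologicalSpace P] {F : P → ℝ → 𝔼 2}
    {p₀ : P} {N : Set P} (hN : N ∈ 𝓝 p₀) {I : Set ℝ} (hI : IsOpen I) {a b : ℝ}
    (hab : Icc a b ⊆ I)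
    (hval : ContinuousOn (fun z : P × ℝ => F z.1 z.2) (N ×ˢ I))
    (hder : ContinuousOn (fun z : P × ℝ => deriv (F z.1) z.2) (N ×ˢ I))
    (hdiff : ∀ p ∈ N, ∀ t ∈ I, DifferentiableAt ℝ (F p) t)
    (hinj : InjOn (F p₀) (Icc a b)) (himm : ∀ t ∈ Icc a b, deriv (F p₀) t ≠ 0) :
    ∀ᶠ p in 𝓝 p₀, InjOn (F p) (Icc a b) := by
  have hp₀N : p₀ ∈ N := mem_of_mem_nhds hN
  -- Step 1: uniform injectivity intervals around each point of `[a, b]`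
  have step1 : ∀ t₀ ∈ Icc a b, ∃ η > 0, ∃ N₁ ∈ 𝓝 p₀, Ioo (t₀ - η) (t₀ + η) ⊆ I ∧
      ∀ p ∈ N₁, InjOn (F p) (Ioo (t₀ - η) (t₀ + η)) := by
    intro t₀ ht₀
    have ht₀I : t₀ ∈ I := hab ht₀
    -- a coordinate of the velocity is nonzero
    obtain ⟨i, hi⟩ : ∃ i : Fin 2, deriv (F p₀) t₀ i ≠ 0 := by
      by_contra hcon
      push Not at hcon
      exact himm t₀ ht₀ (by ext i; simpa using hcon i)
    set d₀ : ℝ := deriv (F p₀) t₀ i with hd₀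
    set σ : ℝ := if 0 < d₀ then 1 else -1 with hσ
    have hσd : 0 < σ * d₀ := by
      by_cases h : 0 < d₀
      · simp only [hσ, h, if_true, one_mul]
      · simp only [hσ, h, if_false, neg_one_mul, neg_pos]
        exact lt_of_le_of_ne (not_lt.1 h) hi
    -- continuity of `(p, t) ↦ σ ∂ₜF p t i` at `(p₀, t₀)`
    have hcont : ContinuousWithinAt (fun z : P × ℝ => σ * deriv (F z.1) z.2 i) (N ×ˢ I)
        (p₀, t₀) := by
      have h1 : ContinuousWithinAt (fun z : P × ℝ => deriv (F z.1) z.2) (N ×ˢ I) (p₀, t₀) :=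
        hder (p₀, t₀) ⟨hp₀N, ht₀I⟩
      have h2 : ContinuousWithinAt (fun z : P × ℝ => deriv (F z.1) z.2 i) (N ×ˢ I) (p₀, t₀) :=
        ((EuclideanSpace.proj (𝕜 := ℝ) i).continuous.continuousAt).comp_continuousWithinAt h1
      exact continuousWithinAt_const.mul h2
    have hev : ∀ᶠ z in 𝓝[N ×ˢ I] ((p₀, t₀) : P × ℝ), 0 < σ * deriv (F z.1) z.2 i :=
      hcont.eventually (Ioi_mem_nhds hσd)
    have hev' : ∀ᶠ z in 𝓝 ((p₀, t₀) : P × ℝ), z ∈ N ×ˢ I → 0 < σ * deriv (F z.1) z.2 i :=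
      eventually_nhdsWithin_iff.1 hev
    -- extract a product neighbourhood `N₁ × (t₀ - η, t₀ + η)`
    obtain ⟨U, hU, V, hV, hUV⟩ := mem_nhds_prod_iff.1 hev'
    obtain ⟨η₁, hη₁, hballV⟩ := Metric.mem_nhds_iff.1 hV
    obtain ⟨η₂, hη₂, hballI⟩ := Metric.mem_nhds_iff.1 (hI.mem_nhds ht₀I)
    set η := min η₁ η₂ with hη
    have hηpos : 0 < η := lt_min hη₁ hη₂
    have hIoo_ball : ∀ {r : ℝ}, Ioo (t₀ - r) (t₀ + r) = ball t₀ r := fun {r} => by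
      ext t; rw [mem_ball, Real.dist_eq, abs_sub_lt_iff, mem_Ioo]; constructor <;> intro h <;>
        constructor <;> linarith [h.1, h.2]
    have hsubI : Ioo (t₀ - η) (t₀ + η) ⊆ I := fun t ht => by
      apply hballI
      rw [hIoo_ball] at ht
      exact ball_subset_ball (min_le_right _ _) ht
    have hsubV : Ioo (t₀ - η) (t₀ + η) ⊆ V := fun t ht => by
      apply hballV
      rw [hIoo_ball] at ht
      exact ball_subset_ball (min_le_left _ _) ht
    refine ⟨η, hηpos, U ∩ N, inter_mem hU hN, hsubI, fun p hp => ?_⟩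
    refine injOn_Ioo_of_deriv_coord_sign i (σ := σ) (fun t ht => hdiff p hp.2 t (hsubI ht))
      fun t ht => ?_
    exact hUV (mk_mem_prod hp.1 (hsubV ht)) ⟨hp.2, hsubI ht⟩
  -- Step 2: a finite subcover and a Lebesgue-type number
  choose! η hη N₁ hN₁ hηI hinjN using step1
  have hcover : Icc a b ⊆ ⋃ t₀ ∈ Icc a b, Ioo (t₀ - η t₀ / 2) (t₀ + η t₀ / 2) := by
    intro t ht
    refine mem_iUnion₂.2 ⟨t, ht, ?_⟩
    have := hη t ht
    constructor <;> linarith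
  obtain ⟨T, hTsub, hTfin, hTcover⟩ :=
    isCompact_Icc.elim_finite_subcover_image
      (fun t₀ _ => isOpen_Ioo (a := t₀ - η t₀ / 2) (b := t₀ + η t₀ / 2)) hcover
  -- the uniform neighbourhood and the uniform length
  have hN₂ : (⋂ t₀ ∈ T, N₁ t₀) ∈ 𝓝 p₀ :=
    (biInter_mem hTfin).2 fun t₀ ht₀ => hN₁ t₀ (hTsub ht₀)
  by_cases hTne : T.Nonempty
  swap
  · -- empty cover: `[a, b]` is empty, injectivity is trivial
    rw [not_nonempty_iff_eq_empty] at hTne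
    rw [hTne] at hTcover
    simp only [mem_empty_iff_false, iUnion_of_empty, iUnion_empty, subset_empty_iff] at hTcover
    refine Eventually.of_forall fun p => ?_
    rw [hTcover]
    exact injOn_empty _
  obtain ⟨ηm, hηm_mem, hηm_le⟩ := Set.exists_min_image T η hTfin hTne
  set η₀ : ℝ := η ηm / 2 with hη₀
  have hη₀pos : 0 < η₀ := by have := hη ηm (hTsub hηm_mem); positivity
  have hη₀le : ∀ t₀ ∈ T, η₀ ≤ η t₀ / 2 := fun t₀ ht₀ => by
    rw [hη₀]; linarith [hηm_le t₀ ht₀]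
  -- Step 3: the compact set of far pairs
  set K : Set (ℝ × ℝ) := (Icc a b ×ˢ Icc a b) ∩ {q | η₀ ≤ |q.1 - q.2|} with hK
  have hKc : IsCompact K :=
    (isCompact_Icc.prod isCompact_Icc).inter_right
      (isClosed_le continuous_const (continuous_abs.comp (continuous_fst.sub continuous_snd)))
  have hfar : ∀ᶠ p in 𝓝 p₀, ∀ q ∈ K, F p q.1 ≠ F p q.2 := by
    refine hKc.eventually_forall_of_forall_eventually fun q hq => ?_
    obtain ⟨⟨hs, ht⟩, hqη⟩ := hq
    have hqη' : η₀ ≤ |q.1 - q.2| := hqη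
    have hne : F p₀ q.1 ≠ F p₀ q.2 := by
      intro heq
      have h12 : q.1 = q.2 := hinj hs ht heq
      rw [h12, sub_self, abs_zero] at hqη'
      exact not_lt.2 hqη' hη₀pos
    -- continuity of `(p, (s, t)) ↦ F p s - F p t` at `(p₀, q)` within `N × (I × I)`
    set S3 : Set (P × (ℝ × ℝ)) := N ×ˢ (I ×ˢ I) with hS3
    have hin1 : ContinuousWithinAt (fun z : P × (ℝ × ℝ) => ((z.1, z.2.1) : P × ℝ)) S3 (p₀, q) :=
      continuousWithinAt_fst.prodMk (continuous_fst.comp continuous_snd).continuousWithinAt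
    have hin2 : ContinuousWithinAt (fun z : P × (ℝ × ℝ) => ((z.1, z.2.2) : P × ℝ)) S3 (p₀, q) :=
      continuousWithinAt_fst.prodMk (continuous_snd.comp continuous_snd).continuousWithinAt
    have hm1 : MapsTo (fun z : P × (ℝ × ℝ) => ((z.1, z.2.1) : P × ℝ)) S3 (N ×ˢ I) :=
      fun z hz => ⟨hz.1, hz.2.1⟩
    have hm2 : MapsTo (fun z : P × (ℝ × ℝ) => ((z.1, z.2.2) : P × ℝ)) S3 (N ×ˢ I) :=
      fun z hz => ⟨hz.1, hz.2.2⟩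
    have hc1 : ContinuousWithinAt
        ((fun z : P × ℝ => F z.1 z.2) ∘ fun z : P × (ℝ × ℝ) => ((z.1, z.2.1) : P × ℝ))
        S3 (p₀, q) :=
      ContinuousWithinAt.comp (hval _ ⟨hp₀N, hab hs⟩) hin1 hm1
    have hc2 : ContinuousWithinAt
        ((fun z : P × ℝ => F z.1 z.2) ∘ fun z : P × (ℝ × ℝ) => ((z.1, z.2.2) : P × ℝ))
        S3 (p₀, q) :=
      ContinuousWithinAt.comp (hval _ ⟨hp₀N, hab ht⟩) hin2 hm2
    have hsub := hc1.sub hc2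
    have hev := hsub.eventually_ne (by simpa [Function.comp] using sub_ne_zero.2 hne)
    have hnhd : S3 ∈ 𝓝 ((p₀, q) : P × (ℝ × ℝ)) :=
      prod_mem_nhds hN (prod_mem_nhds (hI.mem_nhds (hab hs)) (hI.mem_nhds (hab ht)))
    have hev' := eventually_nhdsWithin_iff.1 hev
    filter_upwards [hev', hnhd] with z hz hzm
    have h := hz hzm
    simp only [Function.comp_apply, Pi.sub_apply] at h
    exact sub_ne_zero.1 h
  -- assemble
  filter_upwards [hfar, hN₂] with p hpfar hpN
  intro s hs t ht hst
  by_contra hne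
  by_cases hclose : |s - t| < η₀
  · -- close pairs: both in one injectivity interval
    obtain ⟨t₀, ht₀T, hst₀⟩ : ∃ t₀ ∈ T, s ∈ Ioo (t₀ - η t₀ / 2) (t₀ + η t₀ / 2) := by
      have := hTcover hs
      simpa only [mem_iUnion, exists_prop] using this
    have hpN₁ : p ∈ N₁ t₀ := (mem_iInter₂.1 hpN) t₀ ht₀T
    have h2 := hη₀le t₀ ht₀T
    have hsI : s ∈ Ioo (t₀ - η t₀) (t₀ + η t₀) := by
      constructor <;> linarith [hst₀.1, hst₀.2, hη t₀ (hTsub ht₀T)]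
    have htI : t ∈ Ioo (t₀ - η t₀) (t₀ + η t₀) := by
      rw [abs_sub_lt_iff] at hclose
      constructor <;> linarith [hst₀.1, hst₀.2, hclose.1, hclose.2]
    exact hne (hinjN t₀ (hTsub ht₀T) p hpN₁ hsI htI hst)
  · exact hpfar (s, t) ⟨⟨hs, ht⟩, not_lt.1 hclose⟩ hst

end Literature.Topology.FourManifolds
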